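import Summits.CriticalPhenomena.PercolationContinuityZ3.Theorems.PercNearOneGluingNoHeavyLowerTailFrontierDecRowsClusterMarkov
import HarnessLib

/-!
# Cluster decoupling: `(∫_F G₁)(∫ G₂) ≤ ∫_F G₁ G₂` for a cluster-measurable weight `F` and two local decreasing statistics

Support file (prover seat `prim-facecert`, gen 6; `--supports stmt-CriticalPhenomena-4575`).  No named facts, no sorries, no `native_decide`.
This is the general theorem behind the `CD` ("cluster-decoupling") row family of the facecert certificate LP (prim-facecert gen 6,
`code/gen6/cg5/dict5.py gen_cd`): for a pattern `F` of the open cluster of a point `s` (ANY function of the cluster, not necessarily monotone —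
e.g. "the block of `u` among the marked points is exactly `{c}`") and two separations `D₁, D₂` among marked points outside that block,
    `μ(D₁ ∩ D₂ ∩ F) ≥ μ(D₁ ∩ F) · μ(D₂)`.
These quadratic rows are NOT Harris rows (`F` is not monotone) and strictly enlarge the degree-4 certificate cone (pairs-ring KEY plateau `1/46 → 1/56`).

PROOF (three classical steps, all from van den Berg–Häggström–Kahn 2006 §1 as vendored in `Literature…LonePortSumGeneral` /
`…ConditionalPositiveAssociationProofs`).  Write `W̄ = W̄(C_s)` for the pairs meeting the cluster of `s`.
(1) Block independence (BHK display (10), `BHK2006.sum_cond_cluster_sdiff`): given the cluster, the configuration off `W̄` is a fresh product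
    configuration `η`; by locality `Gᵢ(ω) = Gᵢ(ω ∖ W̄)` on the support of `F`, so `∫_F G₁ G₂ = Σ_ω w(ω) F Σ_η w(η) G₁(η ∖ W̄) G₂(η ∖ W̄)`.
(2) Harris in the fresh configuration (`harris_anti_anti`): `Σ_η w G₁(η∖W̄) G₂(η∖W̄) ≥ ψ₁(C_s) ψ₂(C_s)` with `ψᵢ(W) = Σ_η w(η) Gᵢ(η ∖ W̄(W))`.
(3) Monotonicity ("a separation is more likely in a subgraph"): `G₂` antitone and `η ∖ W̄ ⊆ η` give `G₂(η ∖ W̄) ≥ G₂(η)`, so `ψ₂ ≥ ∫ G₂`;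
    and `Σ_ω w F ψ₁(C_s) = ∫_F G₁` by (1) again.
Compare prim-l12-p1's `ClusterMarkovE3.twoLocal_posCorrelation` (same template with `F = 1_{s ↮ X}` and BHK Thm 1.3 in place of step (3)).
* `clusterDecoupling` — the general inequality (weights `F = N ∘ C_s` with `N ≥ 0`, `Gᵢ` antitone, `0 ≤ G₁ ≤ 1`, `G₂ ≤ 1`, local on `{N ∘ C_s ≠ 0}`).
-/

noncomputable section

namespace Summit.CriticalPhenomena.PercolationContinuityZ3.Theorems

namespace ClusterDecoupling

open MeasureTheory Literature.Probability.Percolation Literature.Probability.LatticeModels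
open BHK2006 DecisionTree LonePortSum LonePortSumGeneral
open scoped Classical

variable {V : Type*} [Fintype V]

/-- **Cluster decoupling.**  For a point `s`, a nonnegative function `N` of the open edge cluster `C_s`, and bounded antitone statistics
`0 ≤ G₁ ≤ 1`, `G₂ ≤ 1` that are LOCAL off the cluster on the support of `N ∘ C_s` (`Gᵢ(ω ∖ W̄(C_s ω)) = Gᵢ ω` whenever `N (C_s ω) ≠ 0`):
`(∫ N(C_s) G₁ dμ) · (∫ G₂ dμ) ≤ ∫ N(C_s) G₁ G₂ dμ`. [this work] -/
theorem clusterDecoupling (w : Sym2 V → unitInterval) (s : V) (N : Set (Sym2 V) → ℝ) (hN0 : ∀ C, 0 ≤ N C)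
    (G₁ G₂ : BondConfig V → ℝ) (hG₁ : Antitone G₁) (hG₂ : Antitone G₂)
    (h₁0 : ∀ ω, 0 ≤ G₁ ω) (h₁1 : ∀ ω, G₁ ω ≤ 1) (h₂1 : ∀ ω, G₂ ω ≤ 1)
    (hloc₁ : ∀ ω : BondConfig V, N (openEdgeCluster ω s) ≠ 0 →
      G₁ (ω \ {e | ∃ v ∈ e, v = s ∨ ∃ e' ∈ openEdgeCluster ω s, v ∈ e'}) = G₁ ω)
    (hloc₂ : ∀ ω : BondConfig V, N (openEdgeCluster ω s) ≠ 0 →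
      G₂ (ω \ {e | ∃ v ∈ e, v = s ∨ ∃ e' ∈ openEdgeCluster ω s, v ∈ e'}) = G₂ ω) :
    (∫ ω, N (openEdgeCluster ω s) * G₁ ω ∂(prodBernoulli w)) * (∫ ω, G₂ ω ∂(prodBernoulli w)) ≤
      ∫ ω, N (openEdgeCluster ω s) * (G₁ ω * G₂ ω) ∂(prodBernoulli w) := by
  classical
  set w' : Sym2 V → ℝ := fun e => (w e : ℝ) with hw'
  have hw0 : ∀ e, 0 ≤ w' e := fun e => (w e).2.1
  have hw1 : ∀ e, w' e ≤ 1 := fun e => (w e).2.2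
  have hm : ∑ ω, weight w' ω = 1 := by
    have h1 := integral_prodBernoulli_eq_sum w fun _ => (1 : ℝ)
    simp only [integral_const, probReal_univ, smul_eq_mul, mul_one] at h1
    exact h1.symm
  set bar : Set (Sym2 V) → Set (Sym2 V) := fun W => {e : Sym2 V | ∃ v ∈ e, v = s ∨ ∃ e' ∈ W, v ∈ e'} with hbar
  -- the conditional means in the fresh configuration
  set ψ₁ : Set (Sym2 V) → ℝ := fun W => ∑ η, weight w' η * G₁ (η \ bar W) with hψ₁
  set ψ₂ : Set (Sym2 V) → ℝ := fun W => ∑ η, weight w' η * G₂ (η \ bar W) with hψ₂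
  set ψ₁₂ : Set (Sym2 V) → ℝ := fun W => ∑ η, weight w' η * (G₁ (η \ bar W) * G₂ (η \ bar W)) with hψ₁₂
  set m₂ : ℝ := ∑ η, weight w' η * G₂ η with hm₂
  have hψ₁0 : ∀ W, 0 ≤ ψ₁ W := fun W =>
    Finset.sum_nonneg fun η _ => mul_nonneg (weight_nonneg hw0 hw1 η) (h₁0 _)
  -- (2) Harris in the fresh configuration
  have hHarris : ∀ W, ψ₁ W * ψ₂ W ≤ ψ₁₂ W := by
    intro W
    have hf : Antitone (fun η : Set (Sym2 V) => G₁ (η \ bar W)) := fun a b hab =>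
      hG₁ (Set.sdiff_subset_sdiff_left hab)
    have hg : Antitone (fun η : Set (Sym2 V) => G₂ (η \ bar W)) := fun a b hab =>
      hG₂ (Set.sdiff_subset_sdiff_left hab)
    exact harris_anti_anti hw0 hw1 hm hf hg (fun a => h₁1 _) (fun a => h₂1 _)
  -- (3) monotonicity: deleting pairs only helps a decreasing statistic
  have hψ₂ge : ∀ W, m₂ ≤ ψ₂ W := by
    intro W
    refine Finset.sum_le_sum fun η _ => mul_le_mul_of_nonneg_left ?_ (weight_nonneg hw0 hw1 η)
    exact hG₂ Set.sdiff_subset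
  -- pointwise locality identities
  have hptw₁ : ∀ ω : BondConfig V, N (openEdgeCluster ω s) * G₁ ω =
      N (openEdgeCluster ω s) * G₁ (ω \ bar (openEdgeCluster ω s)) := by
    intro ω
    by_cases hω : N (openEdgeCluster ω s) = 0
    · rw [hω, zero_mul, zero_mul]
    · rw [hloc₁ ω hω]
  have hptw₁₂ : ∀ ω : BondConfig V, N (openEdgeCluster ω s) * (G₁ ω * G₂ ω) =
      N (openEdgeCluster ω s) * (G₁ (ω \ bar (openEdgeCluster ω s)) * G₂ (ω \ bar (openEdgeCluster ω s))) := by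
    intro ω
    by_cases hω : N (openEdgeCluster ω s) = 0
    · rw [hω, zero_mul, zero_mul]
    · rw [hloc₁ ω hω, hloc₂ ω hω]
  -- (1) block independence, twice
  have e1 := sum_cond_cluster_sdiff w' hm s (fun C ξ => N C * G₁ ξ)
  have e12 := sum_cond_cluster_sdiff w' hm s (fun C ξ => N C * (G₁ ξ * G₂ ξ))
  have i1 : ∫ ω, N (openEdgeCluster ω s) * G₁ ω ∂(prodBernoulli w) =
      ∑ ω, weight w' ω * (N (openEdgeCluster ω s) * ψ₁ (openEdgeCluster ω s)) := by
    rw [integral_prodBernoulli_eq_sum]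
    have lhs : ∑ ω, weight w' ω * (N (openEdgeCluster ω s) * G₁ ω) =
        ∑ ω, weight w' ω * ((fun C ξ => N C * G₁ ξ) (openEdgeCluster ω s)
          (ω \ {e | ∃ v ∈ e, v = s ∨ ∃ e' ∈ openEdgeCluster ω s, v ∈ e'})) :=
      Finset.sum_congr rfl fun ω _ => by simp only; rw [hptw₁ ω]
    rw [lhs, e1]
    refine Finset.sum_congr rfl fun ω _ => ?_
    rw [hψ₁]
    simp only [Finset.mul_sum]
    refine Finset.sum_congr rfl fun η _ => ?_
    ring
  have i2 : ∫ ω, G₂ ω ∂(prodBernoulli w) = m₂ := by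
    rw [integral_prodBernoulli_eq_sum]
  have i12 : ∑ ω, weight w' ω * (N (openEdgeCluster ω s) * ψ₁₂ (openEdgeCluster ω s)) =
      ∫ ω, N (openEdgeCluster ω s) * (G₁ ω * G₂ ω) ∂(prodBernoulli w) := by
    rw [integral_prodBernoulli_eq_sum]
    have rhs : ∑ ω, weight w' ω * (N (openEdgeCluster ω s) * (G₁ ω * G₂ ω)) =
        ∑ ω, weight w' ω * ((fun C ξ => N C * (G₁ ξ * G₂ ξ)) (openEdgeCluster ω s)
          (ω \ {e | ∃ v ∈ e, v = s ∨ ∃ e' ∈ openEdgeCluster ω s, v ∈ e'})) :=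
      Finset.sum_congr rfl fun ω _ => by simp only; rw [hptw₁₂ ω]
    rw [rhs, e12]
    refine Finset.sum_congr rfl fun ω _ => ?_
    rw [hψ₁₂]
    simp only [Finset.mul_sum]
    refine Finset.sum_congr rfl fun η _ => ?_
    ring
  -- assemble: (Σ w N ψ₁) m₂ = Σ w N ψ₁ m₂ ≤ Σ w N ψ₁ ψ₂ ≤ Σ w N ψ₁₂
  rw [i1, i2, ← i12, Finset.sum_mul]
  refine Finset.sum_le_sum fun ω _ => ?_
  have hw_ : 0 ≤ weight w' ω := weight_nonneg hw0 hw1 ω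
  have hNψ : 0 ≤ N (openEdgeCluster ω s) * ψ₁ (openEdgeCluster ω s) := mul_nonneg (hN0 _) (hψ₁0 _)
  have step : N (openEdgeCluster ω s) * ψ₁ (openEdgeCluster ω s) * m₂ ≤
      N (openEdgeCluster ω s) * ψ₁₂ (openEdgeCluster ω s) := by
    calc N (openEdgeCluster ω s) * ψ₁ (openEdgeCluster ω s) * m₂
        ≤ N (openEdgeCluster ω s) * ψ₁ (openEdgeCluster ω s) * ψ₂ (openEdgeCluster ω s) :=
          mul_le_mul_of_nonneg_left (hψ₂ge _) hNψ
      _ = N (openEdgeCluster ω s) * (ψ₁ (openEdgeCluster ω s) * ψ₂ (openEdgeCluster ω s)) := by ring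
      _ ≤ N (openEdgeCluster ω s) * ψ₁₂ (openEdgeCluster ω s) :=
          mul_le_mul_of_nonneg_left (hHarris _) (hN0 _)
  calc weight w' ω * (N (openEdgeCluster ω s) * ψ₁ (openEdgeCluster ω s)) * m₂
      = weight w' ω * (N (openEdgeCluster ω s) * ψ₁ (openEdgeCluster ω s) * m₂) := by ring
    _ ≤ weight w' ω * (N (openEdgeCluster ω s) * ψ₁₂ (openEdgeCluster ω s)) :=
        mul_le_mul_of_nonneg_left step hw_

/-! ### The row form: an exact cluster pattern of `s` against two separations away from the cluster -/

omit [Fintype V] in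
/-- Reachability from `s` is read off the open edge cluster (vertex form of `reachable_iff_exists_mem_openEdgeCluster`). [folklore] -/
theorem reachable_iff_cluster (ω : BondConfig V) (s a : V) :
    (openGraph ω).Reachable s a ↔ (a = s ∨ ∃ e ∈ openEdgeCluster ω s, a ∈ e) :=
  reachable_iff_exists_mem_openEdgeCluster ω s a

/-- **Cluster-decoupling ROW (the `CD` family of the facecert LP).**  For a vertex `s`, vertex sets `Z` ("joined to `s`") and `X` ("separated from
`s`") — the event `F = {s ↔ Z, s ↮ X}` is an arbitrary, in general NON-monotone, pattern of the cluster of `s` — and two separations `D[P|Q]`,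
`D[P'|Q']` with `Q, Q' ⊆ X` (so that on `F` both are read off the configuration away from the cluster):
`μ(F ∩ D[P|Q]) · μ(D[P'|Q']) ≤ μ(F ∩ D[P|Q] ∩ D[P'|Q'])`. [this work] -/
theorem sep_clusterPattern_decoupling (w : Sym2 V → unitInterval) (s : V) (Z X P Q P' Q' : Set V)
    (hQ : Q ⊆ X) (hQ' : Q' ⊆ X) :
    (prodBernoulli w).real ({ω : BondConfig V | (∀ z ∈ Z, (openGraph ω).Reachable s z) ∧ ∀ x ∈ X, ¬ (openGraph ω).Reachable s x} ∩
        {ω : BondConfig V | ∀ p ∈ P, ∀ q ∈ Q, ¬ (openGraph ω).Reachable p q}) *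
      (prodBernoulli w).real {ω : BondConfig V | ∀ p ∈ P', ∀ q ∈ Q', ¬ (openGraph ω).Reachable p q} ≤
    (prodBernoulli w).real ({ω : BondConfig V | (∀ z ∈ Z, (openGraph ω).Reachable s z) ∧ ∀ x ∈ X, ¬ (openGraph ω).Reachable s x} ∩
        ({ω : BondConfig V | ∀ p ∈ P, ∀ q ∈ Q, ¬ (openGraph ω).Reachable p q} ∩
          {ω : BondConfig V | ∀ p ∈ P', ∀ q ∈ Q', ¬ (openGraph ω).Reachable p q})) := by
  classical
  set F : Set (BondConfig V) := {ω | (∀ z ∈ Z, (openGraph ω).Reachable s z) ∧ ∀ x ∈ X, ¬ (openGraph ω).Reachable s x} with hF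
  set D₁ : Set (BondConfig V) := {ω | ∀ p ∈ P, ∀ q ∈ Q, ¬ (openGraph ω).Reachable p q} with hD₁
  set D₂ : Set (BondConfig V) := {ω | ∀ p ∈ P', ∀ q ∈ Q', ¬ (openGraph ω).Reachable p q} with hD₂
  -- the pattern as a function of the edge cluster
  set N : Set (Sym2 V) → ℝ := fun C =>
    if (∀ z ∈ Z, z = s ∨ ∃ e ∈ C, z ∈ e) ∧ ∀ x ∈ X, ¬ (x = s ∨ ∃ e ∈ C, x ∈ e) then 1 else 0 with hN
  have hN0 : ∀ C, 0 ≤ N C := fun C => by simp only [hN]; split_ifs <;> norm_num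
  have hmemF : ∀ ω : BondConfig V, ω ∈ F ↔
      ((∀ z ∈ Z, z = s ∨ ∃ e ∈ openEdgeCluster ω s, z ∈ e) ∧ ∀ x ∈ X, ¬ (x = s ∨ ∃ e ∈ openEdgeCluster ω s, x ∈ e)) := by
    intro ω
    simp only [hF, Set.mem_setOf_eq, reachable_iff_cluster]
  have hind : ∀ ω : BondConfig V, N (openEdgeCluster ω s) = ind F ω := by
    intro ω
    by_cases hω : ω ∈ F
    · rw [ind_of_mem hω, hN]; simp only [if_pos ((hmemF ω).1 hω)]
    · rw [ind_of_not_mem hω, hN]; simp only [if_neg (fun h => hω ((hmemF ω).2 h))]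
  have hmono : ∀ {A : Set (BondConfig V)}, IsLowerSet A → Antitone (ind A) := by
    intro A hA a b hab
    by_cases hb : b ∈ A
    · rw [ind_of_mem hb, ind_of_mem (hA hab hb)]
    · rw [ind_of_not_mem hb]; exact ind_nonneg _ _
  have hFX : ∀ ω : BondConfig V, N (openEdgeCluster ω s) ≠ 0 → ∀ x ∈ X, ¬ (openGraph ω).Reachable s x := by
    intro ω hω
    have hωF : ω ∈ F := by
      by_contra h
      exact hω (by rw [hind ω, ind_of_not_mem h])
    exact hωF.2
  have h := clusterDecoupling w s N hN0 (ind D₁) (ind D₂) (hmono (ClusterMarkovE3.isLowerSet_sepEv P Q)) (hmono (ClusterMarkovE3.isLowerSet_sepEv P' Q'))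
    (fun ω => ind_nonneg _ _) (fun ω => ind_le_one _ _) (fun ω => ind_le_one _ _)
    (fun ω hω => ClusterMarkovE3.ind_sepEv_sdiff_bar P Q X s hQ ω (hFX ω hω)) (fun ω hω => ClusterMarkovE3.ind_sepEv_sdiff_bar P' Q' X s hQ' ω (hFX ω hω))
  -- integrals of indicator products are measures of intersections
  have e1 : ∫ ω, N (openEdgeCluster ω s) * ind D₁ ω ∂(prodBernoulli w) = (prodBernoulli w).real (F ∩ D₁) := by
    rw [integral_prodBernoulli_eq_sum, measureReal_eq_sum]
    refine Finset.sum_congr rfl fun ω _ => ?_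
    rw [hind ω, ind_inter]
  have e2 : ∫ ω, ind D₂ ω ∂(prodBernoulli w) = (prodBernoulli w).real D₂ := by
    rw [integral_prodBernoulli_eq_sum, measureReal_eq_sum]
  have e12 : ∫ ω, N (openEdgeCluster ω s) * (ind D₁ ω * ind D₂ ω) ∂(prodBernoulli w) = (prodBernoulli w).real (F ∩ (D₁ ∩ D₂)) := by
    rw [integral_prodBernoulli_eq_sum, measureReal_eq_sum]
    refine Finset.sum_congr rfl fun ω _ => ?_
    rw [hind ω, ind_inter, ind_inter]
  rw [e1, e2, e12] at h
  exact h

/-! ### The `connEvent`/`sep` vocabulary of the certificate files (lists of terminals, all `n`) -/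

/-- The cluster pattern of `s` as a connectivity predicate: `s` joined to every terminal of `Z` and separated from every terminal of `X`. [this work] -/
def clusterSep {n : ℕ} (s : Fin n) (Z X : List (Fin n)) : CovTransferCert.CRel n → Bool :=
  fun r => (Z.all fun z => r s z) && (X.all fun x => !(r s x))

/-- `connEvent (clusterSep s Z X)` in set-builder form. [this work] -/
theorem connEvent_clusterSep_eq_setOf {n : ℕ} (s : Fin n) (Z X : List (Fin n)) :
    CovTransferCert.connEvent (clusterSep s Z X) =
      {ω : BondConfig (Fin n) | (∀ z ∈ ({v | v ∈ Z} : Set (Fin n)), (openGraph ω).Reachable s z) ∧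
        ∀ x ∈ ({v | v ∈ X} : Set (Fin n)), ¬ (openGraph ω).Reachable s x} := by
  ext ω
  simp only [CovTransferCert.connEvent, clusterSep, Set.mem_setOf_eq, Bool.and_eq_true, List.all_eq_true, Bool.not_eq_true',
    decide_eq_true_eq, decide_eq_false_iff_not, openConn]

/-- **The CD row in the `sep` vocabulary (all `n`)**: for a vertex `s`, terminal lists `Z` (joined to `s`), `X` (separated from `s`) and group separations
`D[P|Q]`, `D[P'|Q']` with `Q, Q' ⊆ X`:  `μ(F ∩ D[P|Q]) · μ(D[P'|Q']) ≤ μ(F ∩ D[P|Q] ∩ D[P'|Q'])`, `F = connEvent (clusterSep s Z X)`. [this work] -/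
theorem clusterSep_sep_decoupling {n : ℕ} (w : Sym2 (Fin n) → unitInterval) (s : Fin n) (Z X P Q P' Q' : List (Fin n))
    (hQ : ∀ q ∈ Q, q ∈ X) (hQ' : ∀ q ∈ Q', q ∈ X) :
    (prodBernoulli w).real (CovTransferCert.connEvent (clusterSep s Z X) ∩ CovTransferCert.connEvent (E3GroupSepCert.sep P Q)) *
      (prodBernoulli w).real (CovTransferCert.connEvent (E3GroupSepCert.sep P' Q')) ≤
    (prodBernoulli w).real (CovTransferCert.connEvent (clusterSep s Z X) ∩
      (CovTransferCert.connEvent (E3GroupSepCert.sep P Q) ∩ CovTransferCert.connEvent (E3GroupSepCert.sep P' Q'))) := by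
  rw [connEvent_clusterSep_eq_setOf, FrontierDecRows.connEvent_sep_eq_setOf P Q, FrontierDecRows.connEvent_sep_eq_setOf P' Q']
  exact sep_clusterPattern_decoupling w s {v | v ∈ Z} {v | v ∈ X} {v | v ∈ P} {v | v ∈ Q} {v | v ∈ P'} {v | v ∈ Q'}
    (fun q hq => hQ q hq) (fun q hq => hQ' q hq)

end ClusterDecoupling

end Summit.CriticalPhenomena.PercolationContinuityZ3.Theorems
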